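import Summits.QuantumFields.BalabanUV.Beta.BorderJetWardFluct
import Summits.QuantumFields.BalabanUV.Beta.SymBorderJetWard

/-!
# `BalabanUV.Beta.SymBorderJetWardFluct` — binder row D1, «GAUGE-LETTERS» (G3′σ): **THE GAUGE WARD IDENTITY OF THE (0.4)-SYMMETRISED ROOTED BORDER
# JET `symT2At` IN ITS FLUCTUATION SLOT** — the pair-family twin of G3′ `BorderJetWardFluct`, STATEMENT FOR STATEMENT under an3-g63's dictionary
# `PhiXAt ↦ symPhiXAt`, `L^{-d}·linAvgAt ↦ (d!·L^d)⁻¹·symLinU`, `L^{-2d}·vhUAt ↦ ((d!)²L^{2d})⁻¹·symVhUAt` (as an1's `SymBorderJetWard` twins G3)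
# (β sub-cell; D1 formalisation swarm LEAF PROVER 02, road «FP» ROUTE T, (COV-m) order 2)

HONEST FRAMING (cell charter, verbatim): «discharging BetaPertH makes Balaban's UV stability UNCONDITIONAL — a real
constructive-QFT result; it is NOT the continuum limit and NOT the Clay problem.»
HONEST DEPENDENCY: continuum YM on T⁴ ⇐ BetaPertH ∧ nine spine estimates (0/9 proved); BetaPertH ⇐ (D1) ∧ (D4) ∧ CAP+tail;
G-an2-4 gates asym, D1 and NE2/3/4.
DERIVED cell leaf ([folklore] nested dual numbers + the symmetrised rooted averaging calculus), BY NAME over G3′ (the family-INDEPENDENT slot data `uS ubS shiftω`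
and chart lemmas `gaugeF_GfL ∕ gaugeB_GbL`, the bridge `shiftω_ι_eq_wU`), an1's G1σ `SymRootedGaugeCovariance.symPhiGAt_gauge`, `SymRootedJetReflection`
(`symPhiLAt`, `symQjetLAt`, `kσ_symPhiLAt`), `SymRootedJetLinear` (`symQjetLAt_add ∕ _neg ∕ _τ-mul`), `SymRootedT2JetDictionary` (`c00 ∕ c10 ∕ c01_symQjetAt_upF`),
`SymRootedJetDictionary.aug_symPhiGAt_eq_one`, node 12 (`wU`, `wU_apply`, `grad`, `gmode1`, `gmode2o`), leaf-05's `TruncatedNil4Calculus`.  No statement of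
Bałaban's papers, no `[cite:]`, no `def`, no `Prop` fact.  Discharges NO binder; 0∕4.  NOT D1, NOT `BetaPertH`, NOT continuum, NOT Clay.  «not in print; our bookkeeping».

WHAT (`r = L·y + ρ`, `ℓ = L^d`, `ℓ²_! = (d!)²·L^{2d}`):
* §1 `symPhiLAt_gauge` (`Ē E = 1`): `symΦ^L_ρ(shiftω a E Ē ω; E, Ē) = uS a r · symΦ^L_ρ(ω; E, Ē) · ubS a (r + L e_μ)`; under augmentation-one backgrounds
  `fst_symPhiLAt`, `symPhiLAt_mul_invT_eq` (`symΦ(ω)·invT symΦ(0) = 1 + σ·symQjetLAt ρ ω E Ē`), **MASTER `symQjetLAt_gauge`**, `symQjetLAt_zero`, and the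
  fluctuation-free **WARD IDENTITY `symQjetLAt_shift : symQjetLAt ρ (shiftω a E Ē 0) E Ē = a r − symΦ(0).fst·a (r + L e_μ)·(invT symΦ(0)).fst`**.
* §2 (`(d!:𝕜) ≠ 0`, `(L:𝕜) ≠ 0`, char ≠ 2; ANY `λ : sites → 𝔸`) **`c11_symQjetAt_grad`**: `c11 symQ^ρ(upF ∇λ; B, B′) = c11(symΦ₀·ι(λ(r + L e_μ))·invT symΦ₀)
  − (2ℓ²_!)⁻¹•symVhUAt ρ [B,λ₊] B′ − (2ℓ²_!)⁻¹•symVhUAt ρ [B′,λ₊] B − (d!·ℓ)⁻¹•symLinU ρ [B,[B′,λ₊]]`, `symΦ₀ = (symPhiRAt ρ 0 B B′).fst`; **`symT2At_gauge_fluct`**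
  = the sum over the two orders of the pair.
NOT HERE: the `(0,3)`-entries (G4-B′σ `SymBorderWardSiteLawFluct`), packing, the torus face.
Provenance: D1 formalisation swarm LEAF PROVER 02, unit b2b-balaban-beta-d1-formalise-leaf-02 gen 23, 2026-08-23; no existing file touched.
-/

namespace Summit.QuantumFields.BalabanUV.Beta.SymBorderJetWardFluct

open Finset
open scoped Nat
open Literature.MathematicalPhysics.QuantumFieldTheory.Balaban1983to89
open Literature.MathematicalPhysics.QuantumFieldTheory.Balaban1983to89.Beta
open AffineAveraging (Form1 unitVec)
open AveragingContours (grad)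
open AveragingGaugeModes (gmode1)
open Summit.QuantumFields.BalabanUV.Beta.SymAveragingHessianCounts (symVhUAt symLinU)
open AveragingThirdJet (Tau Rho dmk fst_dmk snd_dmk dfst_mul dsnd_mul dmk_eq upF upF_apply Ebg Ebi logT invT augR augR_apply gaugeF gaugeB
  logT_dmk_one c00_Ebg c00_Ebi Ebi_mul_Ebg wU wU_apply gmode2o)
open AveragingThirdJet.Tau (τ₁ τ₂ τ12 ι c00 c10 c01 c11 mk ext4)
open Summit.QuantumFields.BalabanUV.Beta.SymAveragingMixedJetTables (symPhiGAt symQjetAt symT2At symPhiRAt)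
open Summit.QuantumFields.BalabanUV.Beta.TruncatedNil4Calculus (nil4_augR mul_invT_eq_one invT_mul_eq_one)
open Summit.QuantumFields.BalabanUV.Beta.SymRootedJetDictionary (aug_symPhiGAt_eq_one)
open Summit.QuantumFields.BalabanUV.Beta.SymRootedGaugeCovariance (symPhiGAt_gauge)
open Summit.QuantumFields.BalabanUV.Beta.RootedJetReflection (GfL GbL fst_GfL snd_GfL fst_GbL snd_GbL augR_GfL augR_GbL)
open Summit.QuantumFields.BalabanUV.Beta.SymRootedJetReflection (symPhiLAt symQjetLAt symQjetAt_eq_symQjetLAt symPhiRAt_eq_symPhiLAt kσ_symPhiLAt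
  snd_symPhiLAt_zero snd_invT_symPhiLAt_zero)
open Summit.QuantumFields.BalabanUV.Beta.SymRootedJetLinear (symQjetLAt_add symQjetLAt_neg symQjetLAt_τ₁_mul symQjetLAt_τ₂_mul symQjetLAt_τ12_mul)
open Summit.QuantumFields.BalabanUV.Beta.SymRootedT2JetDictionary (c00_symQjetAt_upF c10_symQjetAt_upF c01_symQjetAt_upF)
open Summit.QuantumFields.BalabanUV.Beta.BorderJetWardFluct (uS ubS uS_mul_ubS ubS_mul_uS shiftω gaugeF_GfL gaugeB_GbL shiftω_ι_eq_wU)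

variable {𝕜 : Type*} [Field 𝕜] {d : ℕ} {𝔸 : Type*} [Ring 𝔸] [Algebra 𝕜 𝔸]

/-! ## §1 The chart averaging on the pair family under the fluctuation-slot gauge (the chart lemmas are G3′'s BY NAME) -/

section Slot

variable (a : (Fin d → ℤ) → Tau 𝔸)

/-- [folklore] **THE SYMMETRISED CHART AVERAGING UNDER THE FLUCTUATION-SLOT GAUGE** (an1's G1σ `symPhiGAt_gauge`; `Ē E = 1`):
`symΦ^L_ρ(ω′; E, Ē) = u(r)·symΦ^L_ρ(ω; E, Ē)·ū(r + L e_μ)`. -/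
theorem symPhiLAt_gauge (E Eb ω : Form1 d (Tau 𝔸)) (hEE : ∀ κ x, Eb κ x * E κ x = 1) (ρ : Fin d → ℤ) (L : ℕ) (μ : Fin d) (y : Fin d → ℤ) :
    symPhiLAt 𝕜 ρ (shiftω a E Eb ω) E Eb L μ y
      = uS a ((L : ℤ) • y + ρ) * symPhiLAt 𝕜 ρ ω E Eb L μ y * ubS a ((L : ℤ) • y + ρ + (L : ℤ) • unitVec μ) := by
  rw [symPhiLAt, symPhiLAt, ← gaugeF_GfL a E Eb ω hEE, ← gaugeB_GbL a E Eb ω hEE]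
  exact symPhiGAt_gauge (uS_mul_ubS a) (ubS_mul_uS a) ρ L μ y

variable {E Eb : Form1 d (Tau 𝔸)} (hE : ∀ κ x, c00 (E κ x) = 1) (hEb : ∀ κ x, c00 (Eb κ x) = 1)
include hE hEb

/-- [folklore] The fluctuation-free symmetrised averaging has augmentation one. -/
theorem augR_symPhiLAt_zero (ρ : Fin d → ℤ) (L : ℕ) (μ : Fin d) (y : Fin d → ℤ) : augR 𝕜 (symPhiLAt 𝕜 ρ 0 E Eb L μ y) = 1 :=
  aug_symPhiGAt_eq_one (fun κ x => by rw [augR_GfL, hE]) (fun κ x => by rw [augR_GbL, hEb]) ρ L μ y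

omit hE hEb in
/-- [folklore] `symΦ(ω).fst = symΦ(0).fst`. -/
theorem fst_symPhiLAt (ρ : Fin d → ℤ) (ω : Form1 d (Tau 𝔸)) (L : ℕ) (μ : Fin d) (y : Fin d → ℤ) :
    (symPhiLAt 𝕜 ρ ω E Eb L μ y).fst = (symPhiLAt 𝕜 ρ 0 E Eb L μ y).fst := by
  have h := congrArg TrivSqZeroExt.fst (kσ_symPhiLAt (𝕜 := 𝕜) ρ ω E Eb L μ y)
  rw [AveragingMixedJetTables.kσ_apply, fst_dmk] at h
  exact h

/-- [folklore] `symΦ(0).fst · (invT symΦ(0)).fst = 1`. -/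
theorem fst_symPhiLAt_zero_mul_fst_invT (ρ : Fin d → ℤ) (L : ℕ) (μ : Fin d) (y : Fin d → ℤ) :
    (symPhiLAt 𝕜 ρ 0 E Eb L μ y).fst * (invT (symPhiLAt 𝕜 ρ 0 E Eb L μ y)).fst = 1 := by
  have h := congrArg TrivSqZeroExt.fst (mul_invT_eq_one (R := Rho 𝔸) (ag := augR 𝕜) nil4_augR (augR_symPhiLAt_zero hE hEb ρ L μ y))
  rw [dfst_mul] at h
  exact h

/-- [folklore] `symΦ(ω) · invT symΦ(0) = 1 + σ · symQjetLAt ρ ω E Ē`. -/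
theorem symPhiLAt_mul_invT_eq (ρ : Fin d → ℤ) (ω : Form1 d (Tau 𝔸)) (L : ℕ) (μ : Fin d) (y : Fin d → ℤ) :
    symPhiLAt 𝕜 ρ ω E Eb L μ y * invT (symPhiLAt 𝕜 ρ 0 E Eb L μ y) = dmk 1 (symQjetLAt 𝕜 ρ ω E Eb L μ y) := by
  have h1 : (symPhiLAt 𝕜 ρ ω E Eb L μ y * invT (symPhiLAt 𝕜 ρ 0 E Eb L μ y)).fst = 1 := by
    rw [dfst_mul, fst_symPhiLAt (𝕜 := 𝕜) (E := E) (Eb := Eb), fst_symPhiLAt_zero_mul_fst_invT hE hEb]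
  have hX : symPhiLAt 𝕜 ρ ω E Eb L μ y * invT (symPhiLAt 𝕜 ρ 0 E Eb L μ y)
      = dmk 1 (symPhiLAt 𝕜 ρ ω E Eb L μ y * invT (symPhiLAt 𝕜 ρ 0 E Eb L μ y)).snd := by
    rw [← h1]; exact (dmk_eq _).symm
  rw [hX, symQjetLAt, hX, logT_dmk_one, snd_dmk, snd_dmk]

/-- [folklore] **MASTER IDENTITY, FLUCTUATION SLOT, PAIR FAMILY**: `symQjetLAt ρ ω′ E Ē = symQjetLAt ρ ω E Ē + a(r) − symΦ₀·a(r + L e_μ)·invT symΦ₀`. -/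
theorem symQjetLAt_gauge (hEE : ∀ κ x, Eb κ x * E κ x = 1) (ρ : Fin d → ℤ) (ω : Form1 d (Tau 𝔸)) (L : ℕ) (μ : Fin d) (y : Fin d → ℤ) :
    symQjetLAt 𝕜 ρ (shiftω a E Eb ω) E Eb L μ y
      = symQjetLAt 𝕜 ρ ω E Eb L μ y
        + (a ((L : ℤ) • y + ρ)
          - (symPhiLAt 𝕜 ρ 0 E Eb L μ y).fst * a ((L : ℤ) • y + ρ + (L : ℤ) • unitVec μ) * (invT (symPhiLAt 𝕜 ρ 0 E Eb L μ y)).fst) := by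
  have hP := symPhiLAt_mul_invT_eq (𝕜 := 𝕜) hE hEb ρ (shiftω a E Eb ω) L μ y
  rw [symPhiLAt_gauge a E Eb ω hEE] at hP
  have hX : uS a ((L : ℤ) • y + ρ) * symPhiLAt 𝕜 ρ ω E Eb L μ y * ubS a ((L : ℤ) • y + ρ + (L : ℤ) • unitVec μ) * invT (symPhiLAt 𝕜 ρ 0 E Eb L μ y)
      = dmk 1 (symQjetLAt 𝕜 ρ ω E Eb L μ y + (a ((L : ℤ) • y + ρ)
          - (symPhiLAt 𝕜 ρ 0 E Eb L μ y).fst * a ((L : ℤ) • y + ρ + (L : ℤ) • unitVec μ) * (invT (symPhiLAt 𝕜 ρ 0 E Eb L μ y)).fst)) := by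
    have hq : (symPhiLAt 𝕜 ρ ω E Eb L μ y).snd * (invT (symPhiLAt 𝕜 ρ 0 E Eb L μ y)).fst = symQjetLAt 𝕜 ρ ω E Eb L μ y := by
      have h := congrArg TrivSqZeroExt.snd (symPhiLAt_mul_invT_eq (𝕜 := 𝕜) hE hEb ρ ω L μ y)
      rw [dsnd_mul, snd_invT_symPhiLAt_zero, mul_zero, zero_add, snd_dmk] at h
      exact h
    refine TrivSqZeroExt.ext ?_ ?_
    · rw [dfst_mul, dfst_mul, dfst_mul, fst_dmk, fst_symPhiLAt (𝕜 := 𝕜) (E := E) (Eb := Eb)]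
      simp only [uS, ubS, fst_dmk, one_mul, mul_one]
      exact fst_symPhiLAt_zero_mul_fst_invT hE hEb ρ L μ y
    · rw [dsnd_mul, dsnd_mul, dsnd_mul, dfst_mul, dfst_mul, snd_invT_symPhiLAt_zero, mul_zero, zero_add, snd_dmk]
      simp only [uS, ubS, fst_dmk, snd_dmk, one_mul, mul_one]
      rw [fst_symPhiLAt (𝕜 := 𝕜) (E := E) (Eb := Eb) ρ ω, add_mul, add_mul, hq, mul_neg, neg_mul,
        mul_assoc (a ((L : ℤ) • y + ρ)) ((symPhiLAt 𝕜 ρ 0 E Eb L μ y).fst), fst_symPhiLAt_zero_mul_fst_invT hE hEb, mul_one]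
      abel
  rw [hX] at hP
  have h := congrArg TrivSqZeroExt.snd hP
  rw [snd_dmk, snd_dmk] at h
  exact h.symm

/-- [folklore] The symmetrised rooted jet of the zero fluctuation vanishes. -/
theorem symQjetLAt_zero (ρ : Fin d → ℤ) (L : ℕ) (μ : Fin d) (y : Fin d → ℤ) : symQjetLAt 𝕜 ρ 0 E Eb L μ y = 0 := by
  rw [symQjetLAt, mul_invT_eq_one (R := Rho 𝔸) (ag := augR 𝕜) nil4_augR (augR_symPhiLAt_zero hE hEb ρ L μ y), AveragingThirdJet.logT_one]
  rfl

/-- [folklore] **THE FLUCTUATION-SLOT WARD IDENTITY ON THE PAIR FAMILY**: `symQjetLAt ρ (shiftω a E Ē 0) E Ē = a(r) − symΦ₀·a(r + L e_μ)·invT symΦ₀`. -/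
theorem symQjetLAt_shift (hEE : ∀ κ x, Eb κ x * E κ x = 1) (ρ : Fin d → ℤ) (L : ℕ) (μ : Fin d) (y : Fin d → ℤ) :
    symQjetLAt 𝕜 ρ (shiftω a E Eb 0) E Eb L μ y
      = a ((L : ℤ) • y + ρ) - (symPhiLAt 𝕜 ρ 0 E Eb L μ y).fst * a ((L : ℤ) • y + ρ + (L : ℤ) • unitVec μ) * (invT (symPhiLAt 𝕜 ρ 0 E Eb L μ y)).fst := by
  rw [symQjetLAt_gauge a hE hEb hEE, symQjetLAt_zero hE hEb, zero_add]

end Slot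

/-! ## §2 The rooted, symmetrised border jet Ward identity in the fluctuation slot, WITH the root terms -/

section Ward

variable (lam : (Fin d → ℤ) → 𝔸) (hd : ((d ! : ℕ) : 𝕜) ≠ 0) {L : ℕ} (hL : (L : 𝕜) ≠ 0) (h2 : (2 : 𝕜) ≠ 0)
include hd hL h2

/-- [folklore] **THE SYMMETRISED ROOTED BORDER JET WARD IDENTITY, FLUCTUATION SLOT, GENERAL GAUGE PARAMETER**:
`c11 symQ^ρ(upF ∇λ; B, B′) = c11(symΦ₀·ι(λ(r + L e_μ))·invT symΦ₀) − (2ℓ²_!)⁻¹•symVhUAt ρ [B,λ₊] B′ − (2ℓ²_!)⁻¹•symVhUAt ρ [B′,λ₊] B − (d!·ℓ)⁻¹•symLinU ρ [B,[B′,λ₊]]`,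
`ℓ²_! = (d!)²·L^{2d}`, `symΦ₀ = (symPhiRAt ρ 0 B B′).fst`. -/
theorem c11_symQjetAt_grad (ρ : Fin d → ℤ) (B B' : Form1 d 𝔸) (μ : Fin d) (y : Fin d → ℤ) :
    c11 (symQjetAt 𝕜 ρ (upF (grad lam)) B B' L μ y)
      = c11 ((symPhiRAt 𝕜 ρ 0 B B' L μ y).fst * ι (lam ((L : ℤ) • y + ρ + (L : ℤ) • unitVec μ)) * (invT (symPhiRAt 𝕜 ρ 0 B B' L μ y)).fst)
        - ((2 : 𝕜) * (((d ! : ℕ) : 𝕜) ^ 2 * (L : 𝕜) ^ (2 * d)))⁻¹ • symVhUAt ρ (gmode1 B lam) B' L μ y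
        - ((2 : 𝕜) * (((d ! : ℕ) : 𝕜) ^ 2 * (L : 𝕜) ^ (2 * d)))⁻¹ • symVhUAt ρ (gmode1 B' lam) B L μ y
        - (((d ! : ℕ) : 𝕜) * (L : 𝕜) ^ d)⁻¹ • symLinU ρ (gmode2o B B' lam) L μ y := by
  have key := congrArg c11 (symQjetLAt_shift (𝕜 := 𝕜) (fun x => ι (lam x)) (E := Ebg B B') (Eb := Ebi B B')
    (fun κ x => c00_Ebg _ _ κ x) (fun κ x => c00_Ebi _ _ κ x) (fun κ x => Ebi_mul_Ebg _ _ κ x) ρ L μ y)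
  have hw : wU lam B B' = -(upF (grad lam) + (fun κ x => τ₁ * upF (gmode1 B lam) κ x)
      + (fun κ x => τ₂ * upF (gmode1 B' lam) κ x) + (fun κ x => τ12 * upF (gmode2o B B' lam) κ x)) := by
    funext κ x
    simp only [Pi.neg_apply, Pi.add_apply, upF_apply]
    exact wU_apply lam B B' κ x
  rw [shiftω_ι_eq_wU, hw, symQjetLAt_neg, symQjetLAt_add, symQjetLAt_add, symQjetLAt_add, symQjetLAt_τ₁_mul, symQjetLAt_τ₂_mul,
    symQjetLAt_τ12_mul, ← symQjetAt_eq_symQjetLAt, ← symQjetAt_eq_symQjetLAt, ← symQjetAt_eq_symQjetLAt, ← symQjetAt_eq_symQjetLAt,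
    ← symPhiRAt_eq_symPhiLAt] at key
  simp only [AveragingThirdJet.Tau.c11_add, AveragingThirdJet.Tau.c11_neg, AveragingThirdJet.Tau.c11_sub, AveragingThirdJet.Tau.c11_τ₁_mul,
    AveragingThirdJet.Tau.c11_τ₂_mul, AveragingThirdJet.Tau.c11_τ12_mul, AveragingThirdJet.Tau.c11_ι, zero_sub,
    c01_symQjetAt_upF hd hL h2, c10_symQjetAt_upF hd hL h2, c00_symQjetAt_upF hd hL] at key
  have h0 := sub_eq_zero.mpr key
  refine eq_of_sub_eq_zero ?_
  rw [← neg_eq_zero, ← h0]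
  abel

/-- [folklore] **THE GAUGE WARD IDENTITY OF THE SYMMETRISED ROOTED BORDER JET `symT2At` IN ITS FLUCTUATION SLOT** (the sum over the two orders). -/
theorem symT2At_gauge_fluct (ρ : Fin d → ℤ) (B B' : Form1 d 𝔸) (μ : Fin d) (y : Fin d → ℤ) :
    symT2At 𝕜 ρ (upF (grad lam)) B B' L μ y
      = (c11 ((symPhiRAt 𝕜 ρ 0 B B' L μ y).fst * ι (lam ((L : ℤ) • y + ρ + (L : ℤ) • unitVec μ)) * (invT (symPhiRAt 𝕜 ρ 0 B B' L μ y)).fst)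
          - ((2 : 𝕜) * (((d ! : ℕ) : 𝕜) ^ 2 * (L : 𝕜) ^ (2 * d)))⁻¹ • symVhUAt ρ (gmode1 B lam) B' L μ y
          - ((2 : 𝕜) * (((d ! : ℕ) : 𝕜) ^ 2 * (L : 𝕜) ^ (2 * d)))⁻¹ • symVhUAt ρ (gmode1 B' lam) B L μ y
          - (((d ! : ℕ) : 𝕜) * (L : 𝕜) ^ d)⁻¹ • symLinU ρ (gmode2o B B' lam) L μ y)
        + (c11 ((symPhiRAt 𝕜 ρ 0 B' B L μ y).fst * ι (lam ((L : ℤ) • y + ρ + (L : ℤ) • unitVec μ)) * (invT (symPhiRAt 𝕜 ρ 0 B' B L μ y)).fst)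
          - ((2 : 𝕜) * (((d ! : ℕ) : 𝕜) ^ 2 * (L : 𝕜) ^ (2 * d)))⁻¹ • symVhUAt ρ (gmode1 B' lam) B L μ y
          - ((2 : 𝕜) * (((d ! : ℕ) : 𝕜) ^ 2 * (L : 𝕜) ^ (2 * d)))⁻¹ • symVhUAt ρ (gmode1 B lam) B' L μ y
          - (((d ! : ℕ) : 𝕜) * (L : 𝕜) ^ d)⁻¹ • symLinU ρ (gmode2o B' B lam) L μ y) := by
  rw [symT2At, c11_symQjetAt_grad lam hd hL h2, c11_symQjetAt_grad lam hd hL h2]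

end Ward

end Summit.QuantumFields.BalabanUV.Beta.SymBorderJetWardFluct
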